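import Summits.Parity.GeneralizedHardyLittlewood.Theorems.BeyondDiagonalBeatsQuarter.OffDiagPrincipalShort
import Summits.Parity.GeneralizedHardyLittlewood.Theorems.BeyondDiagonalBeatsQuarter.OffDiagKFamilyLargeSieve
import Summits.Parity.GeneralizedHardyLittlewood.Theorems.BeyondDiagonalBeatsQuarter.OffDiagLargeConductorBound
import Summits.Parity.GeneralizedHardyLittlewood.Theorems.BeyondDiagonalBeatsQuarter.MellinBumpPhase
import HarnessLib

/-!
# Route `PrimeLevelFamEdge`, crux K_B (stmt-Parity-20343), line `diagonal_kernel_split` rev 4, plan Ω,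
# OMEGA-BLUEPRINT v4 §3c / TRANSITION-SIZING §4.2+§7 — **the a8P-SHORT bound, ASSEMBLY SKELETON:
# the principal block term at short dual moduli, summed against the mollifier, split at `K₀` samples,
# with the two tools (C1-with-phase W4, k-family large sieve W3) entering AS HYPOTHESES in their landed shapes**

Setting: S4 (`OffDiagPrincipalShort.tsum_levelPrincipal_eq_sum_Icc`, p649153) made the principal block term of ONE
pair `p = (l,m)` a finite lattice-sample sum `φ(n)⁻¹·|h₁|·Σ_{q unit} Σ_{k ≤ N} e(−τ_{p,q}|h₁|k)·𝓕(t₁ ↦ Φ_{p,q}(t₁,|h₁|k))(ξ_q)`.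
The a8P-short object is that term SUMMED AGAINST THE MOLLIFIER: a finite index set `P` of pairs with weights
`w p` (`= c_l c_m`), box weights `Φ p q` and shifts `τ p q` depending on the pair (through `αβ = lm/(d₁d₂)`).

* §1 `sum_mul_tsum_levelPrincipal_eq_sum_Icc` — weights outside, S4 inside, `(l,m)`-sum innermost: the object equals
  `φ(n)⁻¹·|h₁|·Σ_{q unit} Σ_{k∈[1,N]} S(q,k)` with the SAMPLE SUMS
  `S(q,k) := Σ_{p∈P} w p·e(−τ_{p,q}·|h₁|k)·𝓕(t₁ ↦ Φ_{p,q}(t₁,|h₁|k))(ξ_q)` — the bilinear `(l,m)`-sums the tools bound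
  (this is the COMPLETE-`s`-sum term, the `e = 1` term of prover-5's coprime-restricted principal part
  `φ(n₀)⁻¹Σ_{e∣n₀} μ(e)(n₀/e)Σ_k …` — `OffDiagPrincipalCoprime`, in flight; every `e`-term has the same shape with
  `|h₁| ↦ n₀/e`, and §2's generic `norm_density_mul_sum_le_of_split` + §3–§4 apply to each);
* §2 `sum_Icc_one_eq_add_sum_Ioc`, `norm_density_mul_sum_le_of_split`, `norm_sum_mul_tsum_levelPrincipal_le_of_split` —
  split `k ≤ K₀` (few turns: W4) / `K₀ < k ≤ N` (W3) with the two bounds as HYPOTHESES `hW4 : ‖S(q,k)‖ ≤ U₄ q k`,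
  `hW3 : Σ_{K₀<k≤N} ‖S(q,k)‖ ≤ U₃ q`: `‖object‖ ≤ φ(n)⁻¹·|h₁|·Σ_{q unit} (Σ_{k≤K₀} U₄ q k + U₃ q)`;
* §3 W4 ADAPTER `mellinBump_xsq_e` — C1 with a COMPLEX phase `e(Θ·m₁m₂/Y)` (from `MellinBump.mellinBump_xsq_cos/_sin`,
  p648435): the shape that discharges `hW4` at sample `k` (`Θ_k = Y·k/(d₁d₂q(r+1))` turns) once `S(q,k)` is written in
  `xsq`-form with its window `h_k`;
* §4 W3 ADAPTERS in the PRODUCT variable `n = ν p` (`= lm ∈ [1,Y]`, `D = d₁d₂q(r+1)`), from prover-9's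
  `largeSieve_family_mod_nat` (p649393): `sum_mul_e_eq_sum_Icc_fiber` (regroup by `n`), `sum_Icc_norm_sq_fiberSum_le`
  (fibre Cauchy–Schwarz, divisor-type multiplicity `d`), `sum_norm_sq_productPhase_le` / `…_sign_le`
  (`Σ_{k∈𝒦} ‖Σ_p c p·e(σ·ν_p k/D)‖² ≤ m·(Y+1+2D)·d·Σ_p ‖c p‖²`, `σ = ±1`, `m` = multiplicity of `𝒦` mod `D`), the
  `√#𝒦` form `sum_norm_productPhase_le_sqrt`, `sum_norm_productPhase_le_of_separated` for SAMPLE-DEPENDENT weights of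
  finite rank `Σ_{j∈J} u_j(p)·v_j(k)`, `|v_j| ≤ 1` (the large sieve needs `k`-free coefficients; separating the
  `k`-dependence of `𝓕₁Φ_{p,q}(ξ; |h₁|k)` is the consumer's step), and the phase bridge `fourierChar_shift_eq_e_sign` /
  `neg_sign_eq_one_or` (S4's `e(−τ|h₁|k)` with `τ = ν/(h₁D)` IS `e(σ·ν k/D)`, `σ = −sgn h₁ = ±1`).

NOT in this file (the a8P owner's instantiation): the Lipschitz/sup/window constants of `t₁ ↦ 𝓕₁boxWeight` as a
function of `lm/Y`, the finite-rank separation of its `k`-dependence, and the counts `m`, `d` (prover-9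
`card_Ioc_filter_intCast_eq_le`, prover-4 `OffDiagFlatnessCount`). Theorems only; standard axioms. Helper toward
`stub_offDiagBelowSlack_io`; closes nothing.
«The programme SEARCHES and TYPES; no claim about Landau–Siegel zeros, Theorems 1–2 of arXiv:2211.02515 or
a repaired Margin232 until a kernel theorem says so.»
-/

noncomputable section

open Real MeasureTheory Filter Complex Finset
open scoped FourierTransform Topology ContDiff ComplexConjugate

namespace Summit.Parity.GeneralizedHardyLittlewood.Theorems.BeyondDiagonalBeatsQuarter.OffDiag

open Literature.NumberTheory.Sieve.FriedlanderIwaniecPrimes (fourier2)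
open Literature.NumberTheory.Sieve.LargeSieve (e e_eq_exp e_add conj_e norm_e)
open KernelFormXSq (xsq)

/-! ### §1. The a8P-short object: mollifier weights outside, lattice samples inside -/

open Classical in
/-- **The principal block term summed against pair weights, as sample sums.** For a finite set `P` of pairs with
weights `w p`, box weights `Φ p q` (smooth, compact support, heights in `(B₀,B)`, `0 ≤ B₀`, `B ≤ |h₁|(N+1)`), shifts
`τ p q`, frequencies `ξ₁ q`, `h₁ ≠ 0` and bookkeeping modulus `n`:
`Σ_{p∈P} w p·Σ'_s levelPrincipal G (q ↦ Φ̂_{p,q}(ξ₁ q, s/h₁ + τ p q)) n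
   = φ(n)⁻¹·|h₁|·Σ_{q∈G, q unit mod n} Σ_{k∈[1,N]} Σ_{p∈P} w p·e(−τ_{p,q}|h₁|k)·𝓕(t₁ ↦ Φ_{p,q}(t₁,|h₁|k))(ξ₁ q)`.
[folklore] -/
theorem sum_mul_tsum_levelPrincipal_eq_sum_Icc {ι : Type*} (P : Finset ι) (w : ι → ℂ)
    (G : Finset ℕ) (Φ : ι → ℕ → ℝ → ℝ → ℂ)
    (hΦ : ∀ p ∈ P, ∀ q ∈ G, ContDiff ℝ ∞ (Function.uncurry (Φ p q)))
    (hΦc : ∀ p ∈ P, ∀ q ∈ G, HasCompactSupport (Function.uncurry (Φ p q))) {B₀ B : ℝ} (hB₀ : 0 ≤ B₀)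
    (hsupp : ∀ p ∈ P, ∀ q ∈ G, ∀ t₁ t₂, Φ p q t₁ t₂ ≠ 0 → B₀ < t₂ ∧ t₂ < B)
    {h₁ : ℤ} (hh : h₁ ≠ 0) {N : ℕ} (hN : B ≤ (h₁.natAbs : ℝ) * (N + 1)) (ξ₁ : ℕ → ℝ) (τ : ι → ℕ → ℝ)
    (n : ℕ) :
    ∑ p ∈ P, w p * ∑' s : ℤ, levelPrincipal G (fun q ↦ fourier2 (Φ p q) (ξ₁ q) ((s : ℝ) / h₁ + τ p q)) n =
      (Nat.totient n : ℂ)⁻¹ * ((h₁.natAbs : ℂ) *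
        ∑ q ∈ G.filter (fun q : ℕ ↦ IsUnit ((q : ℕ) : ZMod n)), ∑ k ∈ Finset.Icc (1 : ℤ) N,
          ∑ p ∈ P, w p * ((𝐞 (-(τ p q * (h₁.natAbs * k))) : ℂ) *
            𝓕 (fun t₁ : ℝ ↦ Φ p q t₁ (h₁.natAbs * k)) (ξ₁ q))) := by
  classical
  have hS4 : ∀ p ∈ P, w p * ∑' s : ℤ, levelPrincipal G (fun q ↦ fourier2 (Φ p q) (ξ₁ q) ((s : ℝ) / h₁ + τ p q)) n =
      (Nat.totient n : ℂ)⁻¹ * ((h₁.natAbs : ℂ) * (w p *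
        ∑ q ∈ G.filter (fun q : ℕ ↦ IsUnit ((q : ℕ) : ZMod n)), ∑ k ∈ Finset.Icc (1 : ℤ) N,
          (𝐞 (-(τ p q * (h₁.natAbs * k))) : ℂ) * 𝓕 (fun t₁ : ℝ ↦ Φ p q t₁ (h₁.natAbs * k)) (ξ₁ q))) := by
    intro p hp
    rw [tsum_levelPrincipal_eq_sum_Icc G (Φ p) (hΦ p hp) (hΦc p hp) hB₀ (hsupp p hp) hh hN ξ₁ (τ p) n]
    ring
  rw [Finset.sum_congr rfl hS4, ← Finset.mul_sum, ← Finset.mul_sum]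
  congr 2
  simp_rw [Finset.mul_sum]
  rw [Finset.sum_comm]
  refine Finset.sum_congr rfl fun q _ ↦ ?_
  rw [Finset.sum_comm]

/-! ### §2. The split at `K₀` samples and the assembly with the two tools as hypotheses -/

/-- `Σ_{k∈[1,N]} = Σ_{k∈[1,K₀]} + Σ_{k∈(K₀,N]}` over the integers, for `K₀ ≤ N`. [folklore] -/
theorem sum_Icc_one_eq_add_sum_Ioc {M : Type*} [AddCommMonoid M] (f : ℤ → M) {K₀ N : ℕ} (hK : K₀ ≤ N) :
    ∑ k ∈ Finset.Icc (1 : ℤ) N, f k = ∑ k ∈ Finset.Icc (1 : ℤ) K₀, f k + ∑ k ∈ Finset.Ioc (K₀ : ℤ) N, f k := by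
  rw [← Finset.sum_union]
  · congr 1
    ext k
    simp only [Finset.mem_union, Finset.mem_Icc, Finset.mem_Ioc]
    omega
  · rw [Finset.disjoint_left]
    intro k hk hk'
    simp only [Finset.mem_Icc, Finset.mem_Ioc] at hk hk'
    omega

/-- **Assembly with the tools as hypotheses (generic sample sums).** For sample sums `S q k`, a split point
`K₀ ≤ N`, a few-turns bound `‖S q k‖ ≤ U₄ q k` on `k ≤ K₀` (W4, C1-with-phase) and a family bound
`Σ_{K₀<k≤N} ‖S q k‖ ≤ U₃ q` (W3, the `k`-family large sieve):
`‖φ⁻¹·(|h₁|·Σ_{q∈Q} Σ_{k∈[1,N]} S q k)‖ ≤ φ⁻¹·|h₁|·Σ_{q∈Q} (Σ_{k≤K₀} U₄ q k + U₃ q)` (`φ, |h₁|` any naturals).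
[folklore] -/
theorem norm_density_mul_sum_le_of_split (Q : Finset ℕ) (S : ℕ → ℤ → ℂ) (φ H : ℕ) {K₀ N : ℕ} (hK : K₀ ≤ N)
    {U₄ : ℕ → ℤ → ℝ} {U₃ : ℕ → ℝ}
    (hW4 : ∀ q ∈ Q, ∀ k ∈ Finset.Icc (1 : ℤ) K₀, ‖S q k‖ ≤ U₄ q k)
    (hW3 : ∀ q ∈ Q, ∑ k ∈ Finset.Ioc (K₀ : ℤ) N, ‖S q k‖ ≤ U₃ q) :
    ‖(φ : ℂ)⁻¹ * ((H : ℂ) * ∑ q ∈ Q, ∑ k ∈ Finset.Icc (1 : ℤ) N, S q k)‖ ≤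
      (φ : ℝ)⁻¹ * (H * ∑ q ∈ Q, (∑ k ∈ Finset.Icc (1 : ℤ) K₀, U₄ q k + U₃ q)) := by
  rw [norm_mul, norm_mul, norm_inv, Complex.norm_natCast, Complex.norm_natCast]
  refine mul_le_mul_of_nonneg_left (mul_le_mul_of_nonneg_left ?_ (Nat.cast_nonneg _))
    (inv_nonneg.2 (Nat.cast_nonneg _))
  refine (norm_sum_le _ _).trans (Finset.sum_le_sum fun q hq ↦ ?_)
  refine (norm_sum_le _ _).trans ?_
  rw [sum_Icc_one_eq_add_sum_Ioc (fun k ↦ ‖S q k‖) hK]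
  exact add_le_add (Finset.sum_le_sum fun k hk ↦ hW4 q hq k hk) (hW3 q hq)

open Classical in
/-- **The a8P-short bound, assembly skeleton.** With the sample sums of §1,
`S(q,k) = Σ_{p∈P} w p·e(−τ_{p,q}|h₁|k)·𝓕(t₁ ↦ Φ_{p,q}(t₁,|h₁|k))(ξ₁ q)`, a split point `K₀ ≤ N` and the two tools
AS HYPOTHESES — W4 (few turns, `k ≤ K₀`): `‖S(q,k)‖ ≤ U₄ q k`; W3 (the `k`-family, `K₀ < k ≤ N`):
`Σ_{K₀<k≤N} ‖S(q,k)‖ ≤ U₃ q` — the principal block term summed against the pair weights obeys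
`‖Σ_{p∈P} w p·Σ'_s levelPrincipal G (Φ̂_{p,·}) n‖ ≤ φ(n)⁻¹·|h₁|·Σ_{q∈G, q unit mod n} (Σ_{k≤K₀} U₄ q k + U₃ q)`.
[folklore] -/
theorem norm_sum_mul_tsum_levelPrincipal_le_of_split {ι : Type*} (P : Finset ι) (w : ι → ℂ)
    (G : Finset ℕ) (Φ : ι → ℕ → ℝ → ℝ → ℂ)
    (hΦ : ∀ p ∈ P, ∀ q ∈ G, ContDiff ℝ ∞ (Function.uncurry (Φ p q)))
    (hΦc : ∀ p ∈ P, ∀ q ∈ G, HasCompactSupport (Function.uncurry (Φ p q))) {B₀ B : ℝ} (hB₀ : 0 ≤ B₀)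
    (hsupp : ∀ p ∈ P, ∀ q ∈ G, ∀ t₁ t₂, Φ p q t₁ t₂ ≠ 0 → B₀ < t₂ ∧ t₂ < B)
    {h₁ : ℤ} (hh : h₁ ≠ 0) {N : ℕ} (hN : B ≤ (h₁.natAbs : ℝ) * (N + 1)) (ξ₁ : ℕ → ℝ) (τ : ι → ℕ → ℝ)
    (n : ℕ) {K₀ : ℕ} (hK : K₀ ≤ N) {U₄ : ℕ → ℤ → ℝ} {U₃ : ℕ → ℝ}
    (hW4 : ∀ q ∈ G.filter (fun q : ℕ ↦ IsUnit ((q : ℕ) : ZMod n)), ∀ k ∈ Finset.Icc (1 : ℤ) K₀,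
      ‖∑ p ∈ P, w p * ((𝐞 (-(τ p q * (h₁.natAbs * k))) : ℂ) *
        𝓕 (fun t₁ : ℝ ↦ Φ p q t₁ (h₁.natAbs * k)) (ξ₁ q))‖ ≤ U₄ q k)
    (hW3 : ∀ q ∈ G.filter (fun q : ℕ ↦ IsUnit ((q : ℕ) : ZMod n)), ∑ k ∈ Finset.Ioc (K₀ : ℤ) N,
      ‖∑ p ∈ P, w p * ((𝐞 (-(τ p q * (h₁.natAbs * k))) : ℂ) *
        𝓕 (fun t₁ : ℝ ↦ Φ p q t₁ (h₁.natAbs * k)) (ξ₁ q))‖ ≤ U₃ q) :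
    ‖∑ p ∈ P, w p * ∑' s : ℤ, levelPrincipal G (fun q ↦ fourier2 (Φ p q) (ξ₁ q) ((s : ℝ) / h₁ + τ p q)) n‖ ≤
      (Nat.totient n : ℝ)⁻¹ * ((h₁.natAbs : ℝ) *
        ∑ q ∈ G.filter (fun q : ℕ ↦ IsUnit ((q : ℕ) : ZMod n)), (∑ k ∈ Finset.Icc (1 : ℤ) K₀, U₄ q k + U₃ q)) := by
  rw [sum_mul_tsum_levelPrincipal_eq_sum_Icc P w G Φ hΦ hΦc hB₀ hsupp hh hN ξ₁ τ n]
  exact norm_density_mul_sum_le_of_split _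
    (fun q k ↦ ∑ p ∈ P, w p * ((𝐞 (-(τ p q * (h₁.natAbs * k))) : ℂ) *
      𝓕 (fun t₁ : ℝ ↦ Φ p q t₁ (h₁.natAbs * k)) (ξ₁ q))) _ _ hK hW4 hW3

/-! ### §3. W4 adapter: C1 with a complex phase -/

/-- `e(t) = cos(2πt) + i·sin(2πt)` as complex numbers. [folklore] -/
theorem fourierChar_coe_eq_cos_add_sin (t : ℝ) :
    ((𝐞 t : ℂ)) = (Real.cos (2 * π * t) : ℂ) + (Real.sin (2 * π * t) : ℂ) * I := by
  rw [show ((𝐞 t : ℂ)) = e t from rfl, e_eq_exp, mul_comm I, Complex.exp_mul_I, Complex.ofReal_cos,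
    Complex.ofReal_sin]

/-- **C1 with a phase of `Θ` turns, complex form.** For the Mellin-bump data of `MellinBump.mellinBump_xsq_bv`
(`h` real, `K`-Lipschitz, supported in `[a,b] ⊂ [a₀,∞)`, `|h| ≤ B`; `M > 1`, `Y ≥ 1`) and every real `Θ`:
`‖Σ_{m₁,m₂ ≤ M} (x_{m₁}/m₁)(x_{m₂}/m₂)·h(m₁m₂/Y)·e(Θ·m₁m₂/Y)‖
   ≤ D·((2B + (K + 2π|Θ|B)(b − a))(1 + |log b|) + 2(K + 2π|Θ|B)·√(bY)/Y)/(1 + log Y)^k`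
(real and imaginary parts by `mellinBump_xsq_cos` / `mellinBump_xsq_sin`).
[cite: KowalskiMichelVanderKam2000, Prop. 5.1 p. 18 — derivation; MontgomeryVaughan2007, §8.1 (8.6)] -/
theorem mellinBump_xsq_e (k : ℕ) {a₀ : ℝ} (ha₀ : 0 < a₀) :
    ∃ D : ℝ, 0 < D ∧ ∀ a b K B Θ : ℝ, a₀ ≤ a → a ≤ b → 0 ≤ K →
      ∀ h : ℝ → ℝ, (∀ x y, |h x - h y| ≤ K * |x - y|) →
      (∀ y, h y ≠ 0 → a ≤ y ∧ y ≤ b) → (∀ y, |h y| ≤ B) → ∀ M : ℝ, 1 < M → ∀ Y : ℝ, 1 ≤ Y →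
        ‖∑ m₁ ∈ Icc 1 ⌊M⌋₊, ∑ m₂ ∈ Icc 1 ⌊M⌋₊,
            ((xsq M m₁ / m₁ * (xsq M m₂ / m₂) * h ((m₁ : ℝ) * m₂ / Y) : ℝ) : ℂ) *
              (𝐞 (Θ * ((m₁ : ℝ) * m₂ / Y)) : ℂ)‖ ≤
          D * ((2 * B + (K + 2 * π * |Θ| * B) * (b - a)) * (1 + |Real.log b|) +
            2 * (K + 2 * π * |Θ| * B) * (Real.sqrt (b * Y) / Y)) / (1 + Real.log Y) ^ k := by
  obtain ⟨D₁, hD₁, hcos⟩ := MellinBump.mellinBump_xsq_cos k ha₀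
  obtain ⟨D₂, hD₂, hsin⟩ := MellinBump.mellinBump_xsq_sin k ha₀
  refine ⟨D₁ + D₂, by positivity, fun a b K B Θ ha hab hK h hLip hsupp hB M hM Y hY ↦ ?_⟩
  have hc := hcos a b K B Θ ha hab hK h hLip hsupp hB M hM Y hY
  have hs := hsin a b K B Θ ha hab hK h hLip hsupp hB M hM Y hY
  set Rc : ℝ := ∑ m₁ ∈ Icc 1 ⌊M⌋₊, ∑ m₂ ∈ Icc 1 ⌊M⌋₊,
    xsq M m₁ / m₁ * (xsq M m₂ / m₂) * (h ((m₁ : ℝ) * m₂ / Y) * Real.cos (2 * π * Θ * ((m₁ : ℝ) * m₂ / Y)))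
    with hRc
  set Rs : ℝ := ∑ m₁ ∈ Icc 1 ⌊M⌋₊, ∑ m₂ ∈ Icc 1 ⌊M⌋₊,
    xsq M m₁ / m₁ * (xsq M m₂ / m₂) * (h ((m₁ : ℝ) * m₂ / Y) * Real.sin (2 * π * Θ * ((m₁ : ℝ) * m₂ / Y)))
    with hRs
  set X : ℝ := ((2 * B + (K + 2 * π * |Θ| * B) * (b - a)) * (1 + |Real.log b|) +
    2 * (K + 2 * π * |Θ| * B) * (Real.sqrt (b * Y) / Y)) / (1 + Real.log Y) ^ k with hX
  have hsum : ∑ m₁ ∈ Icc 1 ⌊M⌋₊, ∑ m₂ ∈ Icc 1 ⌊M⌋₊,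
      ((xsq M m₁ / m₁ * (xsq M m₂ / m₂) * h ((m₁ : ℝ) * m₂ / Y) : ℝ) : ℂ) * (𝐞 (Θ * ((m₁ : ℝ) * m₂ / Y)) : ℂ) =
      (Rc : ℂ) + (Rs : ℂ) * I := by
    rw [hRc, hRs, Complex.ofReal_sum, Complex.ofReal_sum, Finset.sum_mul, ← Finset.sum_add_distrib]
    refine Finset.sum_congr rfl fun m₁ _ ↦ ?_
    rw [Complex.ofReal_sum, Complex.ofReal_sum, Finset.sum_mul, ← Finset.sum_add_distrib]
    refine Finset.sum_congr rfl fun m₂ _ ↦ ?_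
    rw [fourierChar_coe_eq_cos_add_sin, show 2 * π * (Θ * ((m₁ : ℝ) * m₂ / Y)) =
      2 * π * Θ * ((m₁ : ℝ) * m₂ / Y) by ring]
    push_cast
    ring
  calc ‖∑ m₁ ∈ Icc 1 ⌊M⌋₊, ∑ m₂ ∈ Icc 1 ⌊M⌋₊,
        ((xsq M m₁ / m₁ * (xsq M m₂ / m₂) * h ((m₁ : ℝ) * m₂ / Y) : ℝ) : ℂ) * (𝐞 (Θ * ((m₁ : ℝ) * m₂ / Y)) : ℂ)‖
      = ‖(Rc : ℂ) + (Rs : ℂ) * I‖ := by rw [hsum]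
    _ ≤ ‖(Rc : ℂ)‖ + ‖(Rs : ℂ) * I‖ := norm_add_le _ _
    _ = |Rc| + |Rs| := by
        rw [norm_mul, Complex.norm_I, mul_one, Complex.norm_real, Complex.norm_real, Real.norm_eq_abs,
          Real.norm_eq_abs]
    _ ≤ D₁ * X + D₂ * X := by
        have h1 : |Rc| ≤ D₁ * X := by rw [hX, ← mul_div_assoc]; exact hc
        have h2 : |Rs| ≤ D₂ * X := by rw [hX, ← mul_div_assoc]; exact hs
        exact add_le_add h1 h2
    _ = (D₁ + D₂) * X := by ring
    _ = _ := by rw [hX, ← mul_div_assoc]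

/-! ### §4. W3 adapters: the `k`-family large sieve in the product variable -/

/-- **Regrouping by the product variable.** For pairs `p ∈ P` with `n = ν p ∈ [1,Y]`:
`Σ_p c p·e(ν_p·x) = Σ_{n∈[1,Y]} (Σ_{p : ν p = n} c p)·e(n·x)`. [folklore] -/
theorem sum_mul_e_eq_sum_Icc_fiber {ι : Type*} (P : Finset ι) (ν : ι → ℕ) {Y : ℕ}
    (hν : ∀ p ∈ P, ν p ∈ Icc 1 Y) (c : ι → ℂ) (x : ℝ) :
    ∑ p ∈ P, c p * e ((ν p : ℝ) * x) =
      ∑ n ∈ Icc 1 Y, (∑ p ∈ P.filter (fun p ↦ ν p = n), c p) * e ((n : ℝ) * x) := by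
  classical
  rw [← Finset.sum_fiberwise_of_maps_to hν]
  refine Finset.sum_congr rfl fun n _ ↦ ?_
  rw [Finset.sum_mul]
  refine Finset.sum_congr rfl fun p hp ↦ ?_
  rw [(Finset.mem_filter.1 hp).2]

/-- **Fibre Cauchy–Schwarz with a divisor-type multiplicity**: if every fibre `{p ∈ P : ν p = ν p₀}` has at most
`d` elements, `Σ_{n∈[1,Y]} ‖Σ_{p : ν p = n} c p‖² ≤ d·Σ_p ‖c p‖²`. [folklore] -/
theorem sum_Icc_norm_sq_fiberSum_le {ι : Type*} (P : Finset ι) (ν : ι → ℕ) {Y : ℕ}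
    (hν : ∀ p ∈ P, ν p ∈ Icc 1 Y) {d : ℕ} (hd : ∀ p ∈ P, (P.filter (fun p' ↦ ν p' = ν p)).card ≤ d)
    (c : ι → ℂ) :
    ∑ n ∈ Icc 1 Y, ‖∑ p ∈ P.filter (fun p ↦ ν p = n), c p‖ ^ 2 ≤ d * ∑ p ∈ P, ‖c p‖ ^ 2 := by
  classical
  refine (sum_norm_sq_fiber_le P (Icc 1 Y) ν hν c).trans ?_
  rw [Finset.mul_sum]
  exact Finset.sum_le_sum fun p hp ↦
    mul_le_mul_of_nonneg_right (by exact_mod_cast hd p hp) (by positivity)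

/-- **The `k`-family large sieve for pair sums with a product phase.** For pairs `p ∈ P` with product variable
`ν p ∈ [1,Y]` of fibre multiplicity `≤ d`, coefficients `c p`, and a finite family `𝒦 ⊂ ℤ` of samples hitting each
residue mod `D ≥ 1` at most `m` times:
`Σ_{k∈𝒦} ‖Σ_{p∈P} c p·e(ν_p·k/D)‖² ≤ m·((Y + 1 + 2D)·(d·Σ_p ‖c p‖²))` (`largeSieve_family_mod_nat` in `n = ν p`).
[folklore] -/
theorem sum_norm_sq_productPhase_le {ι : Type*} (P : Finset ι) (ν : ι → ℕ) {Y : ℕ}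
    (hν : ∀ p ∈ P, ν p ∈ Icc 1 Y) {d : ℕ} (hd : ∀ p ∈ P, (P.filter (fun p' ↦ ν p' = ν p)).card ≤ d)
    (c : ι → ℂ) (𝒦 : Finset ℤ) {D : ℕ} (hD : 0 < D) {m : ℕ}
    (hm : ∀ r : ZMod D, (𝒦.filter (fun k : ℤ ↦ (k : ZMod D) = r)).card ≤ m) :
    ∑ k ∈ 𝒦, ‖∑ p ∈ P, c p * e ((ν p : ℝ) * k / D)‖ ^ 2 ≤
      m * (((Y : ℝ) + 1 + 2 * D) * (d * ∑ p ∈ P, ‖c p‖ ^ 2)) := by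
  classical
  have hLS := largeSieve_family_mod_nat 𝒦 (fun k : ℤ ↦ k) hD hm
    (fun n : ℕ ↦ ∑ p ∈ P.filter (fun p ↦ ν p = n), c p) Y
  have hre : ∀ k : ℤ, ∑ p ∈ P, c p * e ((ν p : ℝ) * k / D) =
      ∑ n ∈ Icc 1 Y, (∑ p ∈ P.filter (fun p ↦ ν p = n), c p) * e ((n : ℝ) * ((k : ℤ) : ℝ) / D) := by
    intro k
    have h := sum_mul_e_eq_sum_Icc_fiber P ν hν c ((k : ℝ) / D)
    simp only [mul_div_assoc] at h ⊢
    exact h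
  simp only [hre]
  refine hLS.trans ?_
  gcongr
  exact sum_Icc_norm_sq_fiberSum_le P ν hν hd c

/-- **Either sign of the phase.** For `σ = ±1` (S4's phase is `e(−sgn(h₁)·A·k/C)`, i.e. `σ = −sgn h₁`):
`Σ_{k∈𝒦} ‖Σ_p c p·e(σ·ν_p k/D)‖² ≤ m·((Y + 1 + 2D)·(d·Σ_p ‖c p‖²))` (`σ = −1` by complex conjugation).
[folklore] -/
theorem sum_norm_sq_productPhase_sign_le {ι : Type*} (P : Finset ι) (ν : ι → ℕ) {Y : ℕ}
    (hν : ∀ p ∈ P, ν p ∈ Icc 1 Y) {d : ℕ} (hd : ∀ p ∈ P, (P.filter (fun p' ↦ ν p' = ν p)).card ≤ d)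
    (c : ι → ℂ) (𝒦 : Finset ℤ) {D : ℕ} (hD : 0 < D) {m : ℕ}
    (hm : ∀ r : ZMod D, (𝒦.filter (fun k : ℤ ↦ (k : ZMod D) = r)).card ≤ m) {σ : ℝ} (hσ : σ = 1 ∨ σ = -1) :
    ∑ k ∈ 𝒦, ‖∑ p ∈ P, c p * e (σ * ((ν p : ℝ) * k / D))‖ ^ 2 ≤
      m * (((Y : ℝ) + 1 + 2 * D) * (d * ∑ p ∈ P, ‖c p‖ ^ 2)) := by
  rcases hσ with rfl | rfl
  · simp only [one_mul]
    exact sum_norm_sq_productPhase_le P ν hν hd c 𝒦 hD hm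
  · have hconj : ∀ k : ℤ, ‖∑ p ∈ P, c p * e ((-1 : ℝ) * ((ν p : ℝ) * k / D))‖ =
        ‖∑ p ∈ P, conj (c p) * e ((ν p : ℝ) * k / D)‖ := by
      intro k
      rw [← Complex.norm_conj, map_sum]
      refine congr_arg _ (Finset.sum_congr rfl fun p _ ↦ ?_)
      rw [map_mul, conj_e, neg_one_mul, neg_neg]
    simp only [hconj]
    have h := sum_norm_sq_productPhase_le P ν hν hd (fun p ↦ conj (c p)) 𝒦 hD hm
    simpa only [Complex.norm_conj] using h

/-- **`ℓ¹` form over the family**: for `σ = ±1`,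
`Σ_{k∈𝒦} ‖Σ_p c p·e(σ·ν_p k/D)‖ ≤ √#𝒦·√(m·((Y+1+2D)·(d·Σ_p ‖c p‖²)))`. [folklore] -/
theorem sum_norm_productPhase_le_sqrt {ι : Type*} (P : Finset ι) (ν : ι → ℕ) {Y : ℕ}
    (hν : ∀ p ∈ P, ν p ∈ Icc 1 Y) {d : ℕ} (hd : ∀ p ∈ P, (P.filter (fun p' ↦ ν p' = ν p)).card ≤ d)
    (c : ι → ℂ) (𝒦 : Finset ℤ) {D : ℕ} (hD : 0 < D) {m : ℕ}
    (hm : ∀ r : ZMod D, (𝒦.filter (fun k : ℤ ↦ (k : ZMod D) = r)).card ≤ m) {σ : ℝ} (hσ : σ = 1 ∨ σ = -1) :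
    ∑ k ∈ 𝒦, ‖∑ p ∈ P, c p * e (σ * ((ν p : ℝ) * k / D))‖ ≤
      Real.sqrt 𝒦.card * Real.sqrt (m * (((Y : ℝ) + 1 + 2 * D) * (d * ∑ p ∈ P, ‖c p‖ ^ 2))) := by
  have hCS := Real.sum_mul_le_sqrt_mul_sqrt 𝒦 (fun _ ↦ (1 : ℝ))
    (fun k ↦ ‖∑ p ∈ P, c p * e (σ * ((ν p : ℝ) * k / D))‖)
  simp only [one_mul, one_pow, Finset.sum_const, nsmul_eq_mul, mul_one] at hCS
  refine hCS.trans ?_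
  gcongr
  exact sum_norm_sq_productPhase_sign_le P ν hν hd c 𝒦 hD hm hσ

/-- **Sample-dependent weights of finite rank.** If the pair weights at sample `k` SEPARATE as
`c p·Σ_{j∈J} u_j(p)·v_j(k)` with `|v_j(k)| ≤ 1` on the family, the family bound applies term by term in `j`
(`σ = ±1`):
`Σ_{k∈𝒦} ‖Σ_p c p·(Σ_j u_j p·v_j k)·e(σ·ν_p k/D)‖ ≤ Σ_{j∈J} √#𝒦·√(m·((Y+1+2D)·(d·Σ_p ‖c p·u_j p‖²)))`
(the `k`-dependence of the box transform `𝓕₁Φ_{p,q}(ξ; |h₁|k)` must be separated this way before W3 applies).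
[folklore] -/
theorem sum_norm_productPhase_le_of_separated {ι κ : Type*} (P : Finset ι) (ν : ι → ℕ) {Y : ℕ}
    (hν : ∀ p ∈ P, ν p ∈ Icc 1 Y) {d : ℕ} (hd : ∀ p ∈ P, (P.filter (fun p' ↦ ν p' = ν p)).card ≤ d)
    (𝒦 : Finset ℤ) {D : ℕ} (hD : 0 < D) {m : ℕ}
    (hm : ∀ r : ZMod D, (𝒦.filter (fun k : ℤ ↦ (k : ZMod D) = r)).card ≤ m) {σ : ℝ} (hσ : σ = 1 ∨ σ = -1)
    (J : Finset κ) (c : ι → ℂ) (u : κ → ι → ℂ) (v : κ → ℤ → ℂ) (hv : ∀ j ∈ J, ∀ k ∈ 𝒦, ‖v j k‖ ≤ 1) :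
    ∑ k ∈ 𝒦, ‖∑ p ∈ P, c p * (∑ j ∈ J, u j p * v j k) * e (σ * ((ν p : ℝ) * k / D))‖ ≤
      ∑ j ∈ J, Real.sqrt 𝒦.card *
        Real.sqrt (m * (((Y : ℝ) + 1 + 2 * D) * (d * ∑ p ∈ P, ‖c p * u j p‖ ^ 2))) := by
  -- exchange the `p`- and `j`-sums and pull `v j k` out of the `p`-sum
  have hexp : ∀ k : ℤ, ∑ p ∈ P, c p * (∑ j ∈ J, u j p * v j k) * e (σ * ((ν p : ℝ) * k / D)) =
      ∑ j ∈ J, v j k * ∑ p ∈ P, (c p * u j p) * e (σ * ((ν p : ℝ) * k / D)) := by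
    intro k
    simp_rw [Finset.mul_sum, Finset.sum_mul]
    rw [Finset.sum_comm]
    refine Finset.sum_congr rfl fun j _ ↦ Finset.sum_congr rfl fun p _ ↦ ?_
    ring
  have hk : ∀ k ∈ 𝒦, ‖∑ p ∈ P, c p * (∑ j ∈ J, u j p * v j k) * e (σ * ((ν p : ℝ) * k / D))‖ ≤
      ∑ j ∈ J, ‖∑ p ∈ P, (c p * u j p) * e (σ * ((ν p : ℝ) * k / D))‖ := by
    intro k hk
    rw [hexp k]
    refine (norm_sum_le _ _).trans (Finset.sum_le_sum fun j hj ↦ ?_)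
    rw [norm_mul]
    exact mul_le_of_le_one_left (norm_nonneg _) (hv j hj k hk)
  calc ∑ k ∈ 𝒦, ‖∑ p ∈ P, c p * (∑ j ∈ J, u j p * v j k) * e (σ * ((ν p : ℝ) * k / D))‖
      ≤ ∑ k ∈ 𝒦, ∑ j ∈ J, ‖∑ p ∈ P, (c p * u j p) * e (σ * ((ν p : ℝ) * k / D))‖ := Finset.sum_le_sum hk
    _ = ∑ j ∈ J, ∑ k ∈ 𝒦, ‖∑ p ∈ P, (c p * u j p) * e (σ * ((ν p : ℝ) * k / D))‖ := Finset.sum_comm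
    _ ≤ ∑ j ∈ J, Real.sqrt 𝒦.card *
        Real.sqrt (m * (((Y : ℝ) + 1 + 2 * D) * (d * ∑ p ∈ P, ‖c p * u j p‖ ^ 2))) :=
        Finset.sum_le_sum fun j _ ↦
          sum_norm_productPhase_le_sqrt P ν hν hd (fun p ↦ c p * u j p) 𝒦 hD hm hσ

/-- **S4's phase in product form.** With the switched shift `τ = ν/(h₁·D)` (`ν = lm`, `D = d₁d₂q(r+1)`, so that
`A/C = ν/D`), the sample phase of §1 is `e(−τ·|h₁|k) = e(σ·ν·k/D)` with `σ = −sgn h₁ = ±1`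
(`OffDiagPrincipalShort.phase_shift_eq`). [folklore] -/
theorem fourierChar_shift_eq_e_sign {h₁ : ℤ} (hh : h₁ ≠ 0) {D : ℕ} (hD : 0 < D) (ν : ℕ) (k : ℤ) :
    ((𝐞 (-((ν : ℝ) / ((h₁ : ℝ) * D) * ((h₁.natAbs : ℝ) * k))) : ℂ)) =
      e ((-(h₁.sign : ℝ)) * ((ν : ℝ) * k / D)) := by
  have hD' : (D : ℝ) ≠ 0 := by exact_mod_cast hD.ne'
  rw [phase_shift_eq hh hD' (ν : ℝ) k]
  show e _ = e _
  congr 1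
  ring

/-- `−sgn h₁ = ±1` for `h₁ ≠ 0` (the sign hypothesis of the `σ`-lemmas above). [folklore] -/
theorem neg_sign_eq_one_or (h₁ : ℤ) (hh : h₁ ≠ 0) : (-(h₁.sign : ℝ)) = 1 ∨ (-(h₁.sign : ℝ)) = -1 := by
  rcases lt_or_gt_of_ne hh with hneg | hpos
  · left; rw [Int.sign_eq_neg_one_of_neg hneg]; push_cast; ring
  · right; rw [Int.sign_eq_one_of_pos hpos]; push_cast; ring

end Summit.Parity.GeneralizedHardyLittlewood.Theorems.BeyondDiagonalBeatsQuarter.OffDiag
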